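import Mathlib
import Literature.NumberTheory.LFunctions.Zhang2022.Section15BEq1517Assembly
import Literature.NumberTheory.LFunctions.Zhang2022.Section15BEq1517Decay
import Literature.NumberTheory.LFunctions.Zhang2022.Section15Eq1511Edges
import Literature.NumberTheory.LFunctions.Zhang2022.Section15AU021
import HarnessLib

/-!
# Zhang (2022), §15 (15.17): the assembly edge in the shape of the lane's ranged (15.15) —
# `Eq15_11 c′ bChi → (15.15)W[C·(e^{−c𝓛^{1/10}} + 𝓛^{−A})·W, any A ≥ 61] → Eq15_17 c′ bChi`

Topic `Literature/NumberTheory/LFunctions/Zhang2022` (Landau–Siegel audit tree; verdict-neutral).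
Y. Zhang, *Discrete mean estimates and the Landau–Siegel zero*, arXiv:2211.02515v1 (2022)
[Zhang2022LandauSiegel] — **an unrefereed manuscript under adjudication; nothing here asserts or denies
its Theorems 1–2.** `Section15BEq1517Assembly.eq15_17_chi_of` takes the ranged+weighted (15.15) with an
abstract termwise error `E(D)` and the side conditions `(dl, D) = 1`, `E(D)·𝓛⁶⁰ → 0`. The lane's
(15.15)W theorem (`Eq1515.eq15_15_ranged`, seat zl-w15-p1) is stated WITHOUT the coprimality hypothesis
and with the concrete error `C·(e^{−c𝓛^{1/10}} + (𝓛^{A})⁻¹)·∏_{q∣dl}(1 + c₀q^{−9/10})` (`A = 1995` or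
`1994`; any sign of `C`, `c₀`). This file PROVES the adapter, so that the leaf `Eq15_17 c′ bChi` closes
by a one-line application whatever `A ≥ 61` is chosen:

* `eq15_17_chi_of_ranged` — `Eq15_11 c′ bChi →
  (∃ c > 0, ∃ c₀ C, ForAllLarge, (A) → ∀ d l ≥ 1, dl < P·t₀/T³ → ‖𝒟₁ − λ₁Σⱼℛ₁ⱼd^{βⱼ}𝓜₁‖ ≤
  C·(e^{−c𝓛^{1/10}} + (𝓛^{A})⁻¹)·W) → 61 ≤ A → Eq15_17 c′ bChi` (`|C|`, `|c₀|` absorb the signs;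
  `Section15BEq1517Decay.eq15_15_error_decay_pow` gives the decay with `m = 60`);
* `eq15_17_chi_of_ranged_exp` — the same for the pure exponential error;
* `eq15_17_chi_of_eq15_15_ranged` — with (15.11) at `bChi` DISCHARGED from the tree
  (`eq15_11_chi_of_u021 c′ (step15_u021_holds c′)`, both landed): the leaf `Eq15_17 c′ bChi` from the
  ranged (15.15) ALONE.

Theorems only; no definitions, no facts; nothing about Landau–Siegel zeros.

## References

* Y. Zhang, arXiv:2211.02515v1 (2022), §15 (15.15)–(15.17) p. 85. [cite: Zhang2022LandauSiegel, §15 (15.17) p.85]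
-/

noncomputable section

open Complex Real Finset

namespace Literature.NumberTheory.LFunctions.Zhang2022.Typed.Section15B

open Literature.NumberTheory.LFunctions.Zhang2022
open Literature.NumberTheory.LFunctions.Zhang2022.Skeleton
open Literature.NumberTheory.LFunctions.Zhang2022.Typed.Section15A

/-- `|∏(1 + c₀x_q)| ≤ ∏(1 + |c₀|x_q)` for `x_q = q^{−9/10} ≥ 0`. [folklore] -/
private theorem abs_weight_le_weight_abs (c₀ : ℝ) (n : ℕ) :
    |∏ q ∈ n.primeFactors, (1 + c₀ * (q : ℝ) ^ (-(9 / 10 : ℝ)))| ≤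
      ∏ q ∈ n.primeFactors, (1 + |c₀| * (q : ℝ) ^ (-(9 / 10 : ℝ))) := by
  rw [Finset.abs_prod]
  refine Finset.prod_le_prod (fun _ _ => abs_nonneg _) fun q _ => ?_
  have hq0 : 0 ≤ (q : ℝ) ^ (-(9 / 10 : ℝ)) := Real.rpow_nonneg (Nat.cast_nonneg q) _
  calc |1 + c₀ * (q : ℝ) ^ (-(9 / 10 : ℝ))| ≤ |(1 : ℝ)| + |c₀ * (q : ℝ) ^ (-(9 / 10 : ℝ))| := abs_add_le _ _
    _ = 1 + |c₀| * (q : ℝ) ^ (-(9 / 10 : ℝ)) := by rw [abs_one, abs_mul, abs_of_nonneg hq0]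

/-- **(15.17) at `χ·b` from (15.11) and the lane's ranged (15.15)** — the adapter to
`eq15_17_chi_of`: the ranged (15.15) in the shape `∃ c > 0, ∃ c₀ C, ForAllLarge, (A) → ∀ d, l ≥ 1,
dl < P·t₀/T³ → ‖𝒟₁(d,l) − λ₁(d)Σⱼℛ₁ⱼd^{βⱼ}𝓜₁(d,l;1−βⱼ)‖ ≤ C·(e^{−c𝓛^{1/10}} + (𝓛^{A})⁻¹)·∏_{q∣dl}(1 + c₀q^{−9/10})`
(no coprimality hypothesis; any signs of `C`, `c₀`), for any exponent `A ≥ 61`, gives `Eq15_17 c′ bChi`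
together with (15.11) at `bChi`. [cite: Zhang2022LandauSiegel, §15 (15.17) p.85] -/
theorem eq15_17_chi_of_ranged (c' : ℝ) (h11 : Eq15_11 c' bChi) {A : ℕ} (hA : 61 ≤ A)
    (h15R : ∃ c : ℝ, 0 < c ∧ ∃ c₀ C : ℝ, ForAllLarge fun D _ χ => AssumptionA D χ →
      ∀ d l : ℕ, 1 ≤ d → 1 ≤ l → ((d * l : ℕ) : ℝ) < bigP D * t0 D / bigT D ^ 3 →
        ‖calD1 c' χ d l -
            lam1 c' χ d 1 * ∑ j ∈ ({1, 2, 3} : Finset ℕ),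
              calR1 c' χ j * (d : ℂ) ^ betaJ c' D j * calM1 c' χ d l (1 - betaJ c' D j)‖ ≤
          C * (Real.exp (-c * ell D ^ (1 / 10 : ℝ)) + (ell D ^ A)⁻¹) *
            ∏ q ∈ (d * l).primeFactors, (1 + c₀ * (q : ℝ) ^ (-(9 / 10 : ℝ)))) :
    Eq15_17 c' bChi := by
  obtain ⟨c, hc, c₀, C, h15⟩ := h15R
  refine eq15_17_chi_of c' h11 ⟨|c₀|, fun D => |C| * (Real.exp (-c * ell D ^ (1 / 10 : ℝ)) + (ell D ^ A)⁻¹),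
    eq15_15_error_decay_pow (abs_nonneg C) hc (m := 60) (A := A) (by omega), ?_⟩
  -- positivity of `𝓛` for large `D` (so that the error factor is `≥ 0`)
  have hLarge : ForAllLarge fun D _ _ => 3 ≤ D :=
    ForAllLarge.of_le 3 fun D _ _ hD _ _ => hD
  refine (h15.and hLarge).mono ?_
  intro D _ χ _ _ ⟨e15, hD3⟩ hAss d l hd hl hlt _hcop
  have hℓ0 : 0 < ell D := by
    unfold ell; exact Real.log_pos (by exact_mod_cast (show 1 < D by omega))
  have he0 : 0 ≤ Real.exp (-c * ell D ^ (1 / 10 : ℝ)) + (ell D ^ A)⁻¹ := by positivity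
  refine (e15 hAss d l hd hl hlt).trans ?_
  calc C * (Real.exp (-c * ell D ^ (1 / 10 : ℝ)) + (ell D ^ A)⁻¹) *
        ∏ q ∈ (d * l).primeFactors, (1 + c₀ * (q : ℝ) ^ (-(9 / 10 : ℝ)))
      ≤ |C * (Real.exp (-c * ell D ^ (1 / 10 : ℝ)) + (ell D ^ A)⁻¹) *
          ∏ q ∈ (d * l).primeFactors, (1 + c₀ * (q : ℝ) ^ (-(9 / 10 : ℝ)))| := le_abs_self _
    _ = |C| * (Real.exp (-c * ell D ^ (1 / 10 : ℝ)) + (ell D ^ A)⁻¹) *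
          |∏ q ∈ (d * l).primeFactors, (1 + c₀ * (q : ℝ) ^ (-(9 / 10 : ℝ)))| := by
        rw [abs_mul, abs_mul, abs_of_nonneg he0]
    _ ≤ |C| * (Real.exp (-c * ell D ^ (1 / 10 : ℝ)) + (ell D ^ A)⁻¹) *
          ∏ q ∈ (d * l).primeFactors, (1 + |c₀| * (q : ℝ) ^ (-(9 / 10 : ℝ))) :=
        mul_le_mul_of_nonneg_left (abs_weight_le_weight_abs c₀ _) (mul_nonneg (abs_nonneg C) he0)

/-- The same with the PURE exponential error (the printed `O(ε₁)`, `ε₁ = e^{−c𝓛^{1/10}}`).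
[cite: Zhang2022LandauSiegel, §15 (15.17) p.85] -/
theorem eq15_17_chi_of_ranged_exp (c' : ℝ) (h11 : Eq15_11 c' bChi)
    (h15R : ∃ c : ℝ, 0 < c ∧ ∃ c₀ C : ℝ, ForAllLarge fun D _ χ => AssumptionA D χ →
      ∀ d l : ℕ, 1 ≤ d → 1 ≤ l → ((d * l : ℕ) : ℝ) < bigP D * t0 D / bigT D ^ 3 →
        ‖calD1 c' χ d l -
            lam1 c' χ d 1 * ∑ j ∈ ({1, 2, 3} : Finset ℕ),
              calR1 c' χ j * (d : ℂ) ^ betaJ c' D j * calM1 c' χ d l (1 - betaJ c' D j)‖ ≤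
          C * Real.exp (-c * ell D ^ (1 / 10 : ℝ)) *
            ∏ q ∈ (d * l).primeFactors, (1 + c₀ * (q : ℝ) ^ (-(9 / 10 : ℝ)))) :
    Eq15_17 c' bChi := by
  obtain ⟨c, hc, c₀, C, h15⟩ := h15R
  refine eq15_17_chi_of c' h11 ⟨|c₀|, fun D => |C| * Real.exp (-c * ell D ^ (1 / 10 : ℝ)),
    exp_error_decay (abs_nonneg C) hc 60, ?_⟩
  refine h15.mono ?_
  intro D _ χ _ _ e15 hAss d l hd hl hlt _hcop
  have he0 : 0 ≤ Real.exp (-c * ell D ^ (1 / 10 : ℝ)) := (Real.exp_pos _).le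
  refine (e15 hAss d l hd hl hlt).trans ?_
  calc C * Real.exp (-c * ell D ^ (1 / 10 : ℝ)) *
        ∏ q ∈ (d * l).primeFactors, (1 + c₀ * (q : ℝ) ^ (-(9 / 10 : ℝ)))
      ≤ |C * Real.exp (-c * ell D ^ (1 / 10 : ℝ)) *
          ∏ q ∈ (d * l).primeFactors, (1 + c₀ * (q : ℝ) ^ (-(9 / 10 : ℝ)))| := le_abs_self _
    _ = |C| * Real.exp (-c * ell D ^ (1 / 10 : ℝ)) *
          |∏ q ∈ (d * l).primeFactors, (1 + c₀ * (q : ℝ) ^ (-(9 / 10 : ℝ)))| := by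
        rw [abs_mul, abs_mul, abs_of_nonneg he0]
    _ ≤ |C| * Real.exp (-c * ell D ^ (1 / 10 : ℝ)) *
          ∏ q ∈ (d * l).primeFactors, (1 + |c₀| * (q : ℝ) ^ (-(9 / 10 : ℝ))) :=
        mul_le_mul_of_nonneg_left (abs_weight_le_weight_abs c₀ _) (mul_nonneg (abs_nonneg C) he0)

/-- **The leaf `Eq15_17 c′ bChi` from the ranged (15.15) alone**: (15.11) at `bChi` is in the tree
(`Typed.Section15A.eq15_11_chi_of_u021`, `Typed.Section15A.step15_u021_holds`), so for any `A ≥ 61`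
the lane's `eq15_15_ranged` closes the leaf by `eq15_17_chi_of_eq15_15_ranged c′ hA h15R`.
[cite: Zhang2022LandauSiegel, §15 (15.17) p.85] -/
theorem eq15_17_chi_of_eq15_15_ranged (c' : ℝ) {A : ℕ} (hA : 61 ≤ A)
    (h15R : ∃ c : ℝ, 0 < c ∧ ∃ c₀ C : ℝ, ForAllLarge fun D _ χ => AssumptionA D χ →
      ∀ d l : ℕ, 1 ≤ d → 1 ≤ l → ((d * l : ℕ) : ℝ) < bigP D * t0 D / bigT D ^ 3 →
        ‖calD1 c' χ d l -
            lam1 c' χ d 1 * ∑ j ∈ ({1, 2, 3} : Finset ℕ),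
              calR1 c' χ j * (d : ℂ) ^ betaJ c' D j * calM1 c' χ d l (1 - betaJ c' D j)‖ ≤
          C * (Real.exp (-c * ell D ^ (1 / 10 : ℝ)) + (ell D ^ A)⁻¹) *
            ∏ q ∈ (d * l).primeFactors, (1 + c₀ * (q : ℝ) ^ (-(9 / 10 : ℝ)))) :
    Eq15_17 c' bChi :=
  eq15_17_chi_of_ranged c' (eq15_11_chi_of_u021 c' (step15_u021_holds c')) hA h15R

end Literature.NumberTheory.LFunctions.Zhang2022.Typed.Section15B

end
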